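import Literature.Topology.FourManifolds.SymplecticPairStabilizerAdmissible
import Mathlib.Tactic.Group
import Mathlib.Tactic.Linarith
import HarnessLib

/-!
# The integral stabiliser of a pair of coordinate Lagrangians, III: the unipotent radical is
# generated by the compatible shears

Topic `Literature/Topology/FourManifolds`; theorems only, sequel to
`SymplecticPairStabilizerAdmissible.lean` (partition `t : ι → Bool`,
`T₀ = {t = false}`, `T₊ = {t = true}`; admissible automorphisms `F = (A, AS; 0, A⁻ᵀ)` of
`ℤ^{ι × Bool}` stabilising `Λ_A = span δ_{aᵢ}` and `Λ_t = span δ_{(i, t i)}`).  Let `R` be a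
subgroup of admissible automorphisms containing the compatible moves `moveX j n` (`t j = false`),
`moveW i j n` (`t i = false ∨ t j = false`) and `moveZ i j n` (`t i = false ∨ t j = true`).

* `mem_of_fix_single_false` — an admissible `G` fixing every `δ_{a_q}` lies in `R`: it is
  `(1, S; 0, 1)` with `S` symmetric (`symm_of_fix`), `S₊₊ = 0` (`zero_of_fix`) and `b`-part `1`
  (`bCoord_of_fix`), and one kills the entries of `S` one (symmetric pair) at a time by `moveX`
  and `moveW` (induction on the number of nonzero entries);
* `mem_of_blocks_eq_one` — an admissible `F` whose `a`-block is unipotent block upper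
  triangular (`F δ_{a_q} = δ_{a_q}` for `q ∈ T₀`, `(F δ_{a_q})_{a_p} = δ_{pq}` for `p, q ∈ T₊`)
  lies in `R`: kill the `T₀ × T₊` entries one at a time by `moveZ p q` (`p ∈ T₀`), then apply the
  previous step.

Sequel: `SymplecticPairStabilizerGeneration.lean` (reduction of the two diagonal blocks by the
elementary generation of `GLₙ(ℤ)`, and the theorem).

## References

* H. Zieschang, E. Vogt, H.-D. Coldewey, *Surfaces and Planar Discontinuous Groups*, LNM 835
  (1980), §3.6. [ZieschangVogtColdewey1980]
-/

noncomputable section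

namespace Literature.Topology.FourManifolds

open Finset

variable {ι : Type*} [Fintype ι] [DecidableEq ι]

/-! ## Automorphisms fixing the `a`-vectors -/

/-- If the isometry `G` fixes every `δ_{a_q}` then `(G δ_{b_q})_{b_i} = δ_{iq}`. [folklore] -/
theorem bCoord_of_fix (G : (ι × Bool → ℤ) ≃ₗ[ℤ] (ι × Bool → ℤ))
    (hS : ∀ u v, symplForm (G u) (G v) = symplForm u v)
    (hfix : ∀ q, G (Pi.single (q, false) 1) = Pi.single (q, false) 1) (q i : ι) :
    G (Pi.single (q, true) 1) (i, true) = if i = q then 1 else 0 := by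
  rw [apply_true_eq_symplForm (G (Pi.single (q, true) 1)) i, ← hfix i, hS, symplForm_single_false_left,
    one_mul, Pi.single_apply]
  simp only [Prod.mk.injEq, and_true]

/-- If the isometry `G` fixes every `δ_{a_q}` then `S_{iq} = (G δ_{b_q})_{a_i}` is symmetric.
[folklore] -/
theorem symm_of_fix (G : (ι × Bool → ℤ) ≃ₗ[ℤ] (ι × Bool → ℤ))
    (hS : ∀ u v, symplForm (G u) (G v) = symplForm u v)
    (hfix : ∀ q, G (Pi.single (q, false) 1) = Pi.single (q, false) 1) (q i : ι) :
    G (Pi.single (q, true) 1) (i, false) = G (Pi.single (i, true) 1) (q, false) := by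
  have key := hS (Pi.single (i, true) 1) (Pi.single (q, true) 1)
  rw [symplForm_single_true_left, one_mul, Pi.single_apply, if_neg (by simp), neg_zero,
    symplForm_apply] at key
  simp only [bCoord_of_fix G hS hfix] at key
  simp only [mul_ite, mul_one, mul_zero, ite_mul, one_mul, zero_mul, Finset.sum_sub_distrib,
    Finset.sum_ite_eq', Finset.mem_univ, if_true] at key
  linarith

omit [Fintype ι] in
/-- If the admissible `G` fixes every `δ_{a_q}` then `S_{iq} = 0` for `i, q ∈ T₊`. [folklore] -/
theorem zero_of_fix (t : ι → Bool) (G : (ι × Bool → ℤ) ≃ₗ[ℤ] (ι × Bool → ℤ))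
    (hB : ∀ v : ι × Bool → ℤ, (∀ i, v (i, !t i) = 0) → ∀ i, G v (i, !t i) = 0) {q i : ι}
    (hq : t q = true) (hi : t i = true) : G (Pi.single (q, true) 1) (i, false) = 0 := by
  have := hB (Pi.single (q, true) 1) (fun j => ?_) i
  · rwa [hi] at this
  · rw [Pi.single_apply, if_neg]
    intro h
    rw [Prod.mk.injEq] at h
    obtain ⟨rfl, h2⟩ := h
    rw [hq] at h2
    exact absurd h2.symm (by decide)

/-- An isometry fixing every `δ_{a_q}` whose `S` vanishes is the identity. [folklore] -/
theorem eq_one_of_fix (G : (ι × Bool → ℤ) ≃ₗ[ℤ] (ι × Bool → ℤ))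
    (hS : ∀ u v, symplForm (G u) (G v) = symplForm u v)
    (hfix : ∀ q, G (Pi.single (q, false) 1) = Pi.single (q, false) 1)
    (hzero : ∀ q i, G (Pi.single (q, true) 1) (i, false) = 0) : G = 1 := by
  refine LinearEquiv.toLinearMap_injective (LinearMap.pi_ext fun x n => ?_)
  have hn : (Pi.single x n : ι × Bool → ℤ) = n • Pi.single x 1 := by
    rw [← Pi.single_smul, smul_eq_mul, mul_one]
  rw [hn, LinearMap.map_smul, LinearMap.map_smul]
  congr 1
  change G (Pi.single x 1) = Pi.single x 1
  obtain ⟨q, _ | _⟩ := x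
  · exact hfix q
  · funext ⟨i, s⟩
    cases s
    · rw [hzero, Pi.single_apply, if_neg (by simp)]
    · rw [bCoord_of_fix G hS hfix, Pi.single_apply]
      simp only [Prod.mk.injEq, and_true]

/-- **An admissible automorphism fixing every `δ_{a_q}` is a product of compatible `moveX` and
`moveW`** (induction on the number of nonzero entries of its symmetric part `S`, which vanish on
`T₊ × T₊`: kill a diagonal entry `S_{ii}`, `i ∈ T₀`, by `moveX i`, an off-diagonal pair
`S_{iq} = S_{qi}` by `moveW i q`). [folklore] -/
theorem mem_of_fix_single_false (t : ι → Bool)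
    (A : Subgroup ((ι × Bool → ℤ) ≃ₗ[ℤ] (ι × Bool → ℤ)))
    (hA : ∀ F, F ∈ A ↔ ((∀ u v, symplForm (F u) (F v) = symplForm u v) ∧
      (∀ v : ι × Bool → ℤ, (∀ i, v (i, true) = 0) → ∀ i, F v (i, true) = 0) ∧
      (∀ v : ι × Bool → ℤ, (∀ i, v (i, !t i) = 0) → ∀ i, F v (i, !t i) = 0)))
    (R : Subgroup ((ι × Bool → ℤ) ≃ₗ[ℤ] (ι × Bool → ℤ))) (hRA : R ≤ A)
    (hX : ∀ j, t j = false → ∀ n : ℤ, moveX j n ∈ R)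
    (hW : ∀ i j, i ≠ j → (t i = false ∨ t j = false) → ∀ n : ℤ, moveW i j n ∈ R) :
    ∀ (n : ℕ) (G : (ι × Bool → ℤ) ≃ₗ[ℤ] (ι × Bool → ℤ)), G ∈ A →
      (∀ q, G (Pi.single (q, false) 1) = Pi.single (q, false) 1) →
      (Finset.univ.filter fun x : ι × ι => G (Pi.single (x.2, true) 1) (x.1, false) ≠ 0).card ≤ n →
      G ∈ R := by
  intro n
  induction n with
  | zero =>
    intro G hG hfix hcard
    have hzero : ∀ q i, G (Pi.single (q, true) 1) (i, false) = 0 := fun q i => by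
      by_contra h
      have : (i, q) ∈ Finset.univ.filter fun x : ι × ι => G (Pi.single (x.2, true) 1) (x.1, false) ≠ 0 :=
        Finset.mem_filter.2 ⟨Finset.mem_univ _, h⟩
      rw [Nat.le_zero, Finset.card_eq_zero] at hcard
      rw [hcard] at this
      exact absurd this (Finset.notMem_empty _)
    rw [eq_one_of_fix G ((hA G).1 hG).1 hfix hzero]
    exact R.one_mem
  | succ n ih =>
    intro G hG hfix hcard
    set supp := Finset.univ.filter fun x : ι × ι => G (Pi.single (x.2, true) 1) (x.1, false) ≠ 0
      with hsupp
    by_cases hempty : ∀ q i, G (Pi.single (q, true) 1) (i, false) = 0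
    · rw [eq_one_of_fix G ((hA G).1 hG).1 hfix hempty]
      exact R.one_mem
    push Not at hempty
    obtain ⟨q, i, hc⟩ := hempty
    obtain ⟨hGs, -, hGt⟩ := (hA G).1 hG
    set c := G (Pi.single (q, true) 1) (i, false) with hcdef
    -- the compatibility condition: not both `i` and `q` in `T₊`
    have hcond : t i = false ∨ t q = false := by
      cases hi : t i
      · exact Or.inl rfl
      · cases hq : t q
        · exact Or.inr rfl
        · exact absurd (zero_of_fix t G hGt hq hi) hc
    -- the correcting move `r`, in `R`, fixing the `a`-vectors, with its effect on `S`
    obtain ⟨r, hrR, hra, hrS⟩ : ∃ r : (ι × Bool → ℤ) ≃ₗ[ℤ] (ι × Bool → ℤ), r ∈ R ∧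
        (∀ q', r (Pi.single (q', false) 1) = Pi.single (q', false) 1) ∧
        ∀ q' i', (r * G) (Pi.single (q', true) 1) (i', false) =
          G (Pi.single (q', true) 1) (i', false) -
            (if (i' = i ∧ q' = q) ∨ (i' = q ∧ q' = i) then c else 0) := by
      by_cases hiq : i = q
      · subst hiq
        have hti : t i = false := by rcases hcond with h | h <;> exact h
        refine ⟨moveX i (-c), hX i hti (-c), fun q' => moveX_eq_self _ (by simp), fun q' i' => ?_⟩
        rw [linearEquiv_mul_apply]
        by_cases hi' : i' = i
        · rw [hi', moveX_apply_false, bCoord_of_fix G hGs hfix]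
          by_cases hq' : q' = i
          · rw [hq', if_pos rfl, if_pos (Or.inl ⟨rfl, rfl⟩)]; ring
          · rw [if_neg (fun e => hq' e.symm), if_neg]; · ring
            rintro (⟨-, h⟩ | ⟨-, h⟩) <;> exact hq' h
        · rw [moveX_apply_of_ne _ _ _ (by simpa using hi'), if_neg, sub_zero]
          rintro (⟨h, -⟩ | ⟨h, -⟩) <;> exact hi' h
      · refine ⟨moveW i q (-c), hW i q hiq hcond (-c),
          fun q' => moveW_eq_self _ (by simp) (by simp), fun q' i' => ?_⟩
        rw [linearEquiv_mul_apply]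
        by_cases hi'i : i' = i
        · rw [hi'i, moveW_apply_false_left hiq, bCoord_of_fix G hGs hfix]
          by_cases hq' : q' = q
          · rw [hq', if_pos rfl, if_pos (Or.inl ⟨rfl, rfl⟩)]; ring
          · rw [if_neg (fun e => hq' e.symm), if_neg]; · ring
            rintro (⟨-, h⟩ | ⟨h, -⟩)
            · exact hq' h
            · exact hiq h
        · by_cases hi'q : i' = q
          · rw [hi'q, moveW_apply_false_right hiq, bCoord_of_fix G hGs hfix]
            by_cases hq' : q' = i
            · rw [hq', if_pos rfl, if_pos (Or.inr ⟨rfl, rfl⟩)]; ring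
            · rw [if_neg (fun e => hq' e.symm), if_neg]; · ring
              rintro (⟨h, -⟩ | ⟨-, h⟩)
              · exact hiq h.symm
              · exact hq' h
          · rw [moveW_apply_of_ne _ _ _ _ (by simpa using hi'q) (by simpa using hi'i), if_neg, sub_zero]
            rintro (⟨h, -⟩ | ⟨h, -⟩)
            · exact hi'i h
            · exact hi'q h
    -- `r G` is admissible, fixes the `a`-vectors, and has fewer nonzero entries
    have hrG : r * G ∈ A := A.mul_mem (hRA hrR) hG
    have hfix' : ∀ q', (r * G) (Pi.single (q', false) 1) = Pi.single (q', false) 1 := fun q' => by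
      rw [linearEquiv_mul_apply, hfix, hra]
    have hsub : (Finset.univ.filter fun x : ι × ι => (r * G) (Pi.single (x.2, true) 1) (x.1, false) ≠ 0) ⊂
        supp := by
      rw [Finset.ssubset_iff_of_subset]
      · refine ⟨(i, q), Finset.mem_filter.2 ⟨Finset.mem_univ _, hc⟩, fun h => ?_⟩
        rw [Finset.mem_filter, hrS] at h
        exact h.2 (by simp [hcdef])
      · intro x hx
        rw [Finset.mem_filter, hrS] at hx
        rw [hsupp, Finset.mem_filter]
        refine ⟨Finset.mem_univ _, fun h0 => hx.2 ?_⟩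
        rw [h0, zero_sub, neg_eq_zero]
        split_ifs with hor
        · rcases hor with ⟨h1, h2⟩ | ⟨h1, h2⟩
          · rw [hcdef, ← h1, ← h2]; exact h0
          · rw [hcdef, symm_of_fix G hGs hfix, ← h1, ← h2]; exact h0
        · rfl
    have hcard' : (Finset.univ.filter fun x : ι × ι =>
        (r * G) (Pi.single (x.2, true) 1) (x.1, false) ≠ 0).card ≤ n := by
      have := Finset.card_lt_card hsub
      omega
    have hmem : r * G ∈ R := ih (r * G) hrG hfix' hcard'
    have : G = r⁻¹ * (r * G) := by group
    rw [this]
    exact R.mul_mem (R.inv_mem hrR) hmem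

/-! ## Automorphisms with unipotent block upper triangular `a`-block -/

/-- **An admissible automorphism fixing the `δ_{a_q}`, `q ∈ T₀`, and with `T₊ × T₊` block `1` is a
product of compatible moves**: kill the `T₀ × T₊` entries `(F δ_{a_q})_{a_p}` (`p ∈ T₀`, `q ∈ T₊`)
one at a time by `moveZ p q` (induction on their number), then apply `mem_of_fix_single_false`.
[folklore] -/
theorem mem_of_blocks_eq_one (t : ι → Bool)
    (A : Subgroup ((ι × Bool → ℤ) ≃ₗ[ℤ] (ι × Bool → ℤ)))
    (hA : ∀ F, F ∈ A ↔ ((∀ u v, symplForm (F u) (F v) = symplForm u v) ∧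
      (∀ v : ι × Bool → ℤ, (∀ i, v (i, true) = 0) → ∀ i, F v (i, true) = 0) ∧
      (∀ v : ι × Bool → ℤ, (∀ i, v (i, !t i) = 0) → ∀ i, F v (i, !t i) = 0)))
    (R : Subgroup ((ι × Bool → ℤ) ≃ₗ[ℤ] (ι × Bool → ℤ))) (hRA : R ≤ A)
    (hZ : ∀ (i j : ι) (h : i ≠ j), (t i = false ∨ t j = true) → ∀ n : ℤ, moveZ i j h n ∈ R)
    (hX : ∀ j, t j = false → ∀ n : ℤ, moveX j n ∈ R)
    (hW : ∀ i j, i ≠ j → (t i = false ∨ t j = false) → ∀ n : ℤ, moveW i j n ∈ R) :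
    ∀ (n : ℕ) (F : (ι × Bool → ℤ) ≃ₗ[ℤ] (ι × Bool → ℤ)), F ∈ A →
      (∀ q, t q = false → F (Pi.single (q, false) 1) = Pi.single (q, false) 1) →
      (∀ q, t q = true → ∀ p, t p = true →
        F (Pi.single (q, false) 1) (p, false) = if p = q then 1 else 0) →
      (Finset.univ.filter fun x : ι × ι => t x.1 = false ∧ t x.2 = true ∧
        F (Pi.single (x.2, false) 1) (x.1, false) ≠ 0).card ≤ n →
      F ∈ R := by
  -- with no `T₀ × T₊` entries left, `F` fixes every `δ_{a_q}`
  have base : ∀ F : (ι × Bool → ℤ) ≃ₗ[ℤ] (ι × Bool → ℤ), F ∈ A →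
      (∀ q, t q = false → F (Pi.single (q, false) 1) = Pi.single (q, false) 1) →
      (∀ q, t q = true → ∀ p, t p = true →
        F (Pi.single (q, false) 1) (p, false) = if p = q then 1 else 0) →
      (∀ p q, t p = false → t q = true → F (Pi.single (q, false) 1) (p, false) = 0) → F ∈ R := by
    intro F hF h0 h1 h2
    obtain ⟨-, hFa, -⟩ := (hA F).1 hF
    refine mem_of_fix_single_false t A hA R hRA hX hW _ F hF (fun q => ?_) le_rfl
    cases hq : t q
    · exact h0 q hq
    · funext ⟨p, s⟩
      cases s
      · rw [Pi.single_apply]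
        simp only [Prod.mk.injEq, and_true]
        cases hp : t p
        · rw [h2 p q hp hq, if_neg]
          rintro rfl
          rw [hp] at hq
          exact absurd hq (by decide)
        · exact h1 q hq p hp
      · rw [hFa _ (fun i => by simp) p, Pi.single_apply, if_neg (by simp)]
  intro n
  induction n with
  | zero =>
    intro F hF h0 h1 hcard
    refine base F hF h0 h1 fun p q hp hq => ?_
    by_contra h
    have : (p, q) ∈ Finset.univ.filter fun x : ι × ι => t x.1 = false ∧ t x.2 = true ∧
        F (Pi.single (x.2, false) 1) (x.1, false) ≠ 0 :=
      Finset.mem_filter.2 ⟨Finset.mem_univ _, hp, hq, h⟩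
    rw [Nat.le_zero, Finset.card_eq_zero] at hcard
    rw [hcard] at this
    exact absurd this (Finset.notMem_empty _)
  | succ n ih =>
    intro F hF h0 h1 hcard
    by_cases hempty : ∀ p q, t p = false → t q = true → F (Pi.single (q, false) 1) (p, false) = 0
    · exact base F hF h0 h1 hempty
    push Not at hempty
    obtain ⟨p, q, hp, hq, hc⟩ := hempty
    have hpq : p ≠ q := by rintro rfl; rw [hp] at hq; exact absurd hq (by decide)
    obtain ⟨-, hFa, -⟩ := (hA F).1 hF
    set c := F (Pi.single (q, false) 1) (p, false) with hcdef
    set r : (ι × Bool → ℤ) ≃ₗ[ℤ] (ι × Bool → ℤ) := moveZ p q hpq (-c) with hrdef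
    have hrR : r ∈ R := hZ p q hpq (Or.inl hp) (-c)
    -- the entries of `r F`
    have hrF : ∀ q' p', (r * F) (Pi.single (q', false) 1) (p', false) =
        F (Pi.single (q', false) 1) (p', false) -
          if p' = p then c * F (Pi.single (q', false) 1) (q, false) else 0 := by
      intro q' p'
      rw [linearEquiv_mul_apply, hrdef]
      by_cases hp' : p' = p
      · rw [hp', moveZ_apply_false, if_pos rfl]; ring
      · rw [moveZ_apply_of_ne hpq _ _ (by simpa using hp') (by simp), if_neg hp', sub_zero]
    have hrF' : r * F ∈ A := A.mul_mem (hRA hrR) hF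
    have h0' : ∀ q', t q' = false → (r * F) (Pi.single (q', false) 1) = Pi.single (q', false) 1 := by
      intro q' hq'
      rw [linearEquiv_mul_apply, h0 q' hq', hrdef]
      refine moveZ_eq_self hpq _ ?_ ?_
      · rw [Pi.single_apply, if_neg]
        rintro h
        rw [Prod.mk.injEq] at h
        rw [h.1, hq'] at hq
        exact absurd hq (by decide)
      · rw [Pi.single_apply, if_neg (by simp)]
    have h1' : ∀ q', t q' = true → ∀ p', t p' = true →
        (r * F) (Pi.single (q', false) 1) (p', false) = if p' = q' then 1 else 0 := by
      intro q' hq' p' hp'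
      have hp'p : p' ≠ p := by rintro rfl; rw [hp] at hp'; exact absurd hp' (by decide)
      rw [hrF, if_neg hp'p, sub_zero, h1 q' hq' p' hp']
    -- the support shrinks by `(p, q)`
    have hsub : (Finset.univ.filter fun x : ι × ι => t x.1 = false ∧ t x.2 = true ∧
        (r * F) (Pi.single (x.2, false) 1) (x.1, false) ≠ 0) ⊂
        (Finset.univ.filter fun x : ι × ι => t x.1 = false ∧ t x.2 = true ∧
          F (Pi.single (x.2, false) 1) (x.1, false) ≠ 0) := by
      rw [Finset.ssubset_iff_of_subset]
      · refine ⟨(p, q), Finset.mem_filter.2 ⟨Finset.mem_univ _, hp, hq, hc⟩, fun h => ?_⟩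
        rw [Finset.mem_filter, hrF] at h
        refine h.2.2.2 ?_
        rw [if_pos rfl, h1 q hq q hq, if_pos rfl, mul_one, hcdef, sub_self]
      · intro x hx
        rw [Finset.mem_filter, hrF] at hx
        obtain ⟨-, hx1, hx2, hx3⟩ := hx
        refine Finset.mem_filter.2 ⟨Finset.mem_univ _, hx1, hx2, fun h0x => hx3 ?_⟩
        rw [h0x, zero_sub, neg_eq_zero]
        split_ifs with hx1p
        · rw [h1 x.2 hx2 q hq]
          by_cases hqx : q = x.2
          · rw [if_pos hqx, mul_one, hcdef, hqx, ← hx1p]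
            exact h0x
          · rw [if_neg hqx, mul_zero]
        · rfl
    have hcard' : (Finset.univ.filter fun x : ι × ι => t x.1 = false ∧ t x.2 = true ∧
        (r * F) (Pi.single (x.2, false) 1) (x.1, false) ≠ 0).card ≤ n := by
      have := Finset.card_lt_card hsub
      omega
    have hmem : r * F ∈ R := ih (r * F) hrF' h0' h1' hcard'
    have : F = r⁻¹ * (r * F) := by group
    rw [this]
    exact R.mul_mem (R.inv_mem hrR) hmem

end Literature.Topology.FourManifolds

end
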